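import Mathlib

/-!
# Crux `HodgeAbelianVarieties` (stmt-HodgeConjecture-1333), line `cm-pivot-andre` — helper W8: transport of eigen-data along an injective intertwiner

In André's decomposition with CM targets the targets are abelian subvarieties `B_α ↪ B`; the
pull-back `ι = q_α^*` along the surjection `q_α : B ↠ B_α` is an INJECTIVE linear map
`H¹(B_α) → H¹(B)` intertwining the Weil endomorphism `ψ_α^*` (here `TW`) with `θ^*` (here `TV`),
and its range is spanned by a linearly independent family `b` of `TV`-eigenvectors with known
eigenvalues `ev j`. This file proves the pure linear-algebra statement transporting the eigen-data
to `W` (`eigenspace_transport`, the registered helper W8): every eigenspace of `TW` has dimension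
the number of indices `j` with `ev j = μ`, and the eigenspaces for the values of `ev` exhaust `W`.

Proof (folklore linear algebra):

* `eigenspace_eq_span_of_basis` — for an operator DIAGONAL in a basis `B` (`T (B j) = ev j • B j`)
  the eigenspace for `μ` is the span of the `B j` with `ev j = μ`: if `T w = μ • w`, expanding
  `w = Σ c_j B_j` gives `Σ c_j (ev j - μ) B_j = T w - μ w = 0`, so `c_j = 0` unless `ev j = μ`.
* `eigenspace_transport` — pull `b` back along the injective `ι` (`b j = ι (b' j)`); `b'` is
  linearly independent (`LinearIndependent.of_comp`) and spans (`Submodule.map_injective_of_injective`),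
  hence a basis (`Module.Basis.mk`) in which `TW` is diagonal with eigenvalues `ev`
  (apply `ι` and the intertwining relation); conclude by `finrank_span_eq_card` and
  `Submodule.mem_iSup_of_mem`.

Mathlib only; no definition, no named fact.

## References

* [Andre1992HodgeCM] Y. André, Une remarque à propos des cycles de Hodge de type CM, Séminaire de
  Théorie des Nombres, Paris 1989–90, Progr. Math. 102 (1992), 1–7.
* [folklore] eigenspaces of a diagonalisable operator.
-/

set_option linter.dupNamespace false

noncomputable section

namespace Summit.HodgeConjecture.HodgeConjecture.Theorems.HodgeAbelianVarieties.CMPivotAndre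

/-- **Eigenspaces of an operator diagonal in a basis.** If `T (B j) = ev j • B j` for a basis `B`
indexed by a finite type, then the eigenspace of `T` for `μ` is the span of the basis vectors `B j`
with `ev j = μ`: `⊇` is immediate (`Module.End.mem_eigenspace_iff`); for `⊆`, if `T w = μ • w` and
`w = Σ_j c_j • B j` (`Module.Basis.sum_repr`), then `Σ_j (c_j (ev j - μ)) • B j = T w - μ • w = 0`,
so `c_j = 0` whenever `ev j ≠ μ` (`Fintype.linearIndependent_iff`), and `w` lies in the span.
[folklore] -/
theorem eigenspace_eq_span_of_basis {K : Type*} [Field K] {W : Type*} [AddCommGroup W]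
    [Module K W] {J : Type*} [Fintype J] (B : Module.Basis J K W) (T : W →ₗ[K] W) (ev : J → K)
    (hT : ∀ j, T (B j) = ev j • B j) (μ : K) :
    Module.End.eigenspace T μ =
      Submodule.span K (Set.range fun j : {j : J // ev j = μ} ↦ B j) := by
  apply le_antisymm
  · intro w hw
    rw [Module.End.mem_eigenspace_iff] at hw
    -- the relation `Σ_j c_j (ev j - μ) • B j = T w - μ • w = 0`
    have hrel : ∑ j, (B.repr w j * (ev j - μ)) • B j = 0 := by
      have h1 : T w = ∑ j, (B.repr w j * ev j) • B j := by
        conv_lhs => rw [← B.sum_repr w]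
        rw [map_sum]
        refine Finset.sum_congr rfl fun j _ ↦ ?_
        rw [map_smul, hT j, smul_smul]
      have h2 : μ • w = ∑ j, (B.repr w j * μ) • B j := by
        conv_lhs => rw [← B.sum_repr w]
        rw [Finset.smul_sum]
        refine Finset.sum_congr rfl fun j _ ↦ ?_
        rw [smul_smul, mul_comm]
      calc ∑ j, (B.repr w j * (ev j - μ)) • B j
          = ∑ j, ((B.repr w j * ev j) • B j - (B.repr w j * μ) • B j) :=
            Finset.sum_congr rfl fun j _ ↦ by rw [mul_sub, sub_smul]
        _ = T w - μ • w := by rw [Finset.sum_sub_distrib, h1, h2]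
        _ = 0 := by rw [hw, sub_self]
    have hzero : ∀ j, ev j ≠ μ → B.repr w j = 0 := fun j hj ↦
      (mul_eq_zero.1 (Fintype.linearIndependent_iff.1 B.linearIndependent _ hrel j)).resolve_right
        (sub_ne_zero.2 hj)
    rw [← B.sum_repr w]
    refine Submodule.sum_mem _ fun j _ ↦ ?_
    by_cases hj : ev j = μ
    · exact Submodule.smul_mem _ _ (Submodule.subset_span ⟨⟨j, hj⟩, rfl⟩)
    · rw [hzero j hj, zero_smul]
      exact Submodule.zero_mem _
  · rw [Submodule.span_le]
    rintro _ ⟨⟨j, hj⟩, rfl⟩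
    rw [SetLike.mem_coe, Module.End.mem_eigenspace_iff, hT j, hj]

/-- **Transport of eigen-data along an injective intertwiner** (helper W8 of the line
`cm-pivot-andre`, registered signature verbatim). Let `ι : W → V` be injective with
`ι ∘ TW = TV ∘ ι`, and let the range of `ι` be spanned by a linearly independent family `b` of
`TV`-eigenvectors, `TV (b j) = ev j • b j`. Then every eigenspace of `TW` for `μ` has dimension
`#{j | ev j = μ}`, and the eigenspaces of `TW` for the values of `ev` span `W`. Proof: `b j = ι (b' j)`
for a (unique) `b' j`; `b'` is linearly independent (`LinearIndependent.of_comp`) and spans `W`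
(`ι` maps `span b'` and `⊤` both onto `range ι = span b`; `Submodule.map_injective_of_injective`),
so it is a basis (`Module.Basis.mk`) in which `TW` is diagonal with eigenvalues `ev`
(apply the injective `ι`: `ι (TW b'j) = TV (b j) = ev j • b j = ι (ev j • b' j)`); conclude by
`eigenspace_eq_span_of_basis`, `finrank_span_eq_card` and `Submodule.mem_iSup_of_mem`.
[cite: Andre1992HodgeCM, proof of the Théorème] [folklore] -/
theorem eigenspace_transport : ∀ {K : Type} [Field K] {V W : Type} [AddCommGroup V] [Module K V] [AddCommGroup W] [Module K W] [FiniteDimensional K W] (ι : W →ₗ[K] V) (TW : W →ₗ[K] W) (TV : V →ₗ[K] V), Function.Injective ι → ι ∘ₗ TW = TV ∘ₗ ι → ∀ {J : Type} [Fintype J] [DecidableEq K] (b : J → V) (ev : J → K), LinearIndependent K b → (∀ j, TV (b j) = ev j • b j) → LinearMap.range ι = Submodule.span K (Set.range b) → (∀ μ : K, Module.finrank K (Module.End.eigenspace TW μ) = Fintype.card {j : J // ev j = μ}) ∧ (⨆ μ ∈ Finset.univ.image ev, Module.End.eigenspace TW μ) = ⊤ := by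
  intro K _ V W _ _ _ _ _ ι TW TV hι hcomm J _ _ b ev hb hTV hrange
  -- pull the eigenvectors `b j ∈ range ι` back along `ι`
  have hmem : ∀ j, b j ∈ LinearMap.range ι := fun j ↦ by
    rw [hrange]
    exact Submodule.subset_span ⟨j, rfl⟩
  choose b' hb' using hmem
  have hcomp : ⇑ι ∘ b' = b := funext hb'
  have hli' : LinearIndependent K b' := LinearIndependent.of_comp ι (by rw [hcomp]; exact hb)
  have hspan' : Submodule.span K (Set.range b') = ⊤ := by
    apply Submodule.map_injective_of_injective hι
    rw [Submodule.map_span, ← Set.range_comp, hcomp, Submodule.map_top, hrange]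
  -- `b'` is a basis of `W` in which `TW` is diagonal with eigenvalues `ev`
  let B : Module.Basis J K W := Module.Basis.mk hli' hspan'.ge
  have hB : ∀ j, B j = b' j := fun j ↦ Module.Basis.mk_apply hli' hspan'.ge j
  have hTW : ∀ j, TW (B j) = ev j • B j := fun j ↦ by
    rw [hB]
    apply hι
    rw [map_smul, hb', ← hTV, ← hb' j, ← LinearMap.comp_apply, hcomm, LinearMap.comp_apply]
  have heig : ∀ μ, Module.End.eigenspace TW μ =
      Submodule.span K (Set.range fun j : {j : J // ev j = μ} ↦ B j) :=
    eigenspace_eq_span_of_basis B TW ev hTW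
  refine ⟨fun μ ↦ ?_, ?_⟩
  · rw [heig μ]
    exact finrank_span_eq_card (B.linearIndependent.comp _ Subtype.val_injective)
  · rw [eq_top_iff, ← B.span_eq, Submodule.span_le]
    rintro _ ⟨j, rfl⟩
    have hj : B j ∈ Module.End.eigenspace TW (ev j) := Module.End.mem_eigenspace_iff.2 (hTW j)
    exact Submodule.mem_iSup_of_mem (ev j)
      (Submodule.mem_iSup_of_mem (Finset.mem_image_of_mem ev (Finset.mem_univ j)) hj)

end Summit.HodgeConjecture.HodgeConjecture.Theorems.HodgeAbelianVarieties.CMPivotAndre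

end
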